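import Summits.BirchSwinnertonDyer.BirchSwinnertonDyer.Theorems.KimAtThreeShallowEqDeepOffStratumOfDefinedKato
import Summits.BirchSwinnertonDyer.BirchSwinnertonDyer.Theorems.KimAtThreeShallowEqDeepOffStratumOfDefinedKatoWeighted
import Summits.BirchSwinnertonDyer.BirchSwinnertonDyer.Theorems.KimAtThreeShallowEqDeepSplitGlue
import HarnessLib

/-!
# Route `KimAtThreeKolyvagin` (W2): cruxes 19599 / 19077 BY NAME re-keyed on the registered support item 20275
# `DefinedKatoWeightedNonAdditiveThree` (cell `bsd-addord`, seat w2-c4 gen 12; `--supports` 19077, helper)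

HONEST FRAMING.  BY-NAME GLUE, END THEOREMS WHOSE HYPOTHESES ARE ROUTE DECLS (no definition, no named fact, no instance, no
`sorry`).  The planner registered (rev 15 → item 20275, 2026-08-27T13:01Z, director-bsd g9 «GO 20396→weighted») the
WEIGHTED defined-Kato package (C1ₑₓʷ) of the non-additive non-anomalous `t = 0` rows as the route decl
`DefinedKatoWeightedNonAdditiveThree`, superseding item 20396 `DefinedKatoUnitNonAdditiveThree` (crude `b = 1`, which is
false for Kato's DEFINED exp* at wild levels on ordinary rows — memo HOME/w2c4/W2C4-WEIGHTED-COMPAT-g11.md §1).  This file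
is gen 10's OWNER assembly (`KimAtThreeShallowEqDeepOffStratumOfDefinedKato` / `…OfRouteItems`) with 20396 replaced by
20275 everywhere, so that NOTHING in the by-name chain of 19599 / 19077 names 20396 any more:
* §1 `stub19599_nonAdditive_of_weightedRouteItems` — crux 19599's `stub_nonAdditive` (BC3 birth text, VERBATIM) ⟸
  [S24](1)(2) ∧ GZK ∧ PT ∧ 20275 ∧ 20397 (dispatch on the non-anomaly certificate; the non-anomalous branch is gen 11's
  `shallowEqDeep_row_of_definedKatoWeighted_of_nonanomalous`, p526409; the anomalous branch gen 9's
  `shallowEqDeep_row_of_fineKatoτ_of_good`);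
* §2 `shallowEqDeepOffKatoStratum_of_weightedRouteItems` — 19599 BY NAME ⟸ `SakamotoKolyvaginThree ∧ RankEqAnalyticRankLeOne ∧
  PoitouTateSelmerDuality ∧ 20275 ∧ 20397 ∧ 20398`;
* §3 `shallowEqDeepAtTorsionFree_of_weightedRouteItems` — 19077 BY NAME ⟸ the same ∧ `CarayolLevelEqConductor ∧
  KatoKuriharaPortThreeShared` (crux 19560); `shallowEqDeepAtTorsionFree_of_sharedParts_of_weightedRouteItems` — 19077 ⟸
  alias 19598 `DeepUpperSplitSharedParts ∧ 20275 ∧ 20397 ∧ 20398` (the planner's 19600 decomposition);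
* §4 `definedKatoWeightedNonAdditiveThree_iff` (token-for-token: the item IS the displayed `∀ rows, DEFKATOW⟦…⟧`) and
  `definedKatoWeightedNonAdditiveThree_of_definedKatoUnitNonAdditiveThree` (20396 ⟹ 20275, `θ := 1`; nothing registered goes
  stale).  The item's discharger from the Kato side — 20275 ⟸ (S5a) ∧ (S5b-tower) ∧ hKatoV2ʷ — is the sibling file
  `KimAtThreeShallowEqDeepWeightedItemOfKatoV2`.
Nothing closed, nothing booked; 19560 / 19599 / 19077 / 20275 / 20397 / 20398 stay OPEN; BSD is not proved by any of this.
References: [Kato2004Asterisque] (8.1.3), §9.4, Thm. 9.7, Ex. 13.3; [BlochKato1990] §3 Prop. 3.8 / Ex. 3.11;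
[Kim2022StructureSelmer] Thm. 1.9 (6), §3.2.3, Thm. 3.13; [Kim2025RefinedTNC] Thm. 1.1/1.2; [Sakamoto2024] Thm. 4.4;
[MazurRubin2004] Thm. 4.4.1, 5.2.12; [Carayol1986]; memo HOME/w2c4/W2C4-WEIGHTED-COMPAT-g11.md.
-/

set_option autoImplicit false
-- the Theorems namespace of a single-conjunct summit repeats the summit name by design (D-0017)
set_option linter.dupNamespace false

noncomputable section

open scoped NumberField TensorProduct ContRepresentation Classical
open CategoryTheory Field Function Finset IsDedekindDomain NumberField WeierstrassCurve
open Rat.HeightOneSpectrum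
open Literature.NumberTheory.GaloisRepresentations Literature.NumberTheory.GaloisCohomology
open Literature.NumberTheory.GaloisRepresentations.DiscreteGaloisModule
open Literature.NumberTheory.EllipticCurves Literature.NumberTheory.EllipticCurves.ModularForms
open Literature.NumberTheory.EllipticCurves.Rank1Residual
open Literature.NumberTheory.EllipticCurves.Kato2004
open Literature.NumberTheory.EllipticCurves.Kato2004.EulerSystemValues
open Summit.BirchSwinnertonDyer.Rank1Residual.GaloisImage
open Summit.BirchSwinnertonDyer.Rank1Residual.Additive.LocalLog
open Summit.BirchSwinnertonDyer.BirchSwinnertonDyer.Theses.KimAtThreeKolyvagin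
open Summit.BirchSwinnertonDyer.BirchSwinnertonDyer.Theorems
open Summit.BirchSwinnertonDyer.BirchSwinnertonDyer.Theorems.KimAtThreeKolyvaginDefs
open Summit.BirchSwinnertonDyer.BirchSwinnertonDyer.Theorems.KimAtThreeShallowEqDeepSplitGlueNoStub
open Summit.BirchSwinnertonDyer.BirchSwinnertonDyer.Theorems.KimAtThreeShallowEqDeepNonAdditiveOfFineKato
open Summit.BirchSwinnertonDyer.BirchSwinnertonDyer.Theorems.KimAtThreeShallowEqDeepOffStratumOfDefinedKatoWeighted

namespace Summit.BirchSwinnertonDyer.BirchSwinnertonDyer.Theorems.KimAtThreeShallowEqDeepWeightedItems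

/-! ### Local notation (VERBATIM from the assembled files) -/

/-- Local notation: the `stub_nonAdditive` signature of crux 19599 (BC3 birth skeleton
`Cruxes/ShallowEqDeepOffKatoStratum/Lines/birth.lean`), VERBATIM. -/
local notation3 (prettyPrint := false) "STUB19599NA" =>
  ∀ (W₀ : WeierstrassCurve ℚ) [W₀.IsElliptic] [W₀.IsGloballyMinimal],
    (∀ n : ℕ, W₀.HasSurjectiveModNGaloisRep (3 ^ n : ℕ)) →
    Nat.card {Q : (W₀.baseChange ℚ_[3]).toAffine.Point // (3 : ℕ) • Q = 0} = 1 → Finite W₀.sha →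
    ∀ {N : ℕ} [NeZero N], N = W₀.conductorNorm ℤ →
    ∀ (D₀ : Literature.NumberTheory.EllipticCurves.ModularForms.ModularParametrizationData W₀ N),
      (∀ z ∈ D₀.L.lattice, ∃ w ∈ Literature.NumberTheory.EllipticCurves.ModularForms.periodLattice D₀.f, z = D₀.c * w) →
      (∀ (W₂ : WeierstrassCurve ℚ) [W₂.IsElliptic]
        (D₂ : Literature.NumberTheory.EllipticCurves.ModularForms.ModularParametrizationData W₂ N),
        D₂.f = D₀.f → D₀.modularDegree ≤ D₂.modularDegree) →
      (∀ r : ℚ, Literature.NumberTheory.EllipticCurves.ratPlusSymbol D₀.f r ≠ 0 →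
        0 ≤ padicValRat 3 (Literature.NumberTheory.EllipticCurves.ratPlusSymbol D₀.f r)) →
      Literature.NumberTheory.EllipticCurves.kuriharaVanishingOrder W₀ 3 D₀.f = 0 →
      ¬ (haveI : Fact (Nat.Prime 3) := ⟨Nat.prime_three⟩;
          Literature.NumberTheory.EllipticCurves.Rank1Residual.Addv W₀ 3) →
      Literature.NumberTheory.EllipticCurves.kuriharaPartialDeepInfty W₀ 3 D₀.f ≤
        Literature.NumberTheory.EllipticCurves.kuriharaPartialInfty W₀ 3 D₀.f

/-- Local notation: **the WEIGHTED compatibility** at depth `j` with exponent `b` and weights `θ_r ∈ ℚ(ζ_m)`: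
`∃ l ∈ L_int, (1 ⊗ θ_r)·3^b·(φ(h) ⊗ 1 − Λ_{0,r}(y)) = 3^{j+1}·l` (X1-int_b is the case `θ_r = 1`). -/
local notation3 (prettyPrint := false) "COMPATW⟦" W' ", " j ", " v' ", " Λ' ", " φ0 ", " b ", " θ' "⟧" =>
  ∀ (r : Finset (HeightOneSpectrum (𝓞 ℚ)))
    (Ψ : H1 (tateRep W' 3) (cycSubgroup 3 0 r) →+
      continuousCohomology 1 (subgroupRep
        (WeierstrassCurve.torsionGaloisModule W' (((3 : ℕ) : ℤ) ^ j * ((3 : ℕ) : ℤ))).toTopRep (cycSubgroup 3 0 r))),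
    (∀ (φ₁ : contOneCocycles (subgroupRep (tateRep W' 3).toTopRep (cycSubgroup 3 0 r)))
        (ψ : contOneCocycles (subgroupRep
          (WeierstrassCurve.torsionGaloisModule W' (((3 : ℕ) : ℤ) ^ j * ((3 : ℕ) : ℤ))).toTopRep (cycSubgroup 3 0 r))),
        (∀ g, ((ψ.1 g : geomTorsion W' (((3 : ℕ) : ℤ) ^ j * ((3 : ℕ) : ℤ))) : geomPoints W') =
          TateModule.proj 3 (j + 1) (φ₁.1 g)) →
        Ψ (oneCocycleClass _ φ₁) = oneCocycleClass _ ψ) →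
    ∀ (y : H1 (tateRep W' 3) (cycSubgroup 3 0 r))
      (κ₀ : galoisCohomology (WeierstrassCurve.torsionGaloisModule W' (((3 : ℕ) : ℤ) ^ j * ((3 : ℕ) : ℤ))) 1)
      (h : (tateLocalRep W' 3 (Sum.inr v')).cohomology 1),
      resSubgroup (WeierstrassCurve.torsionGaloisModule W' (((3 : ℕ) : ℤ) ^ j * ((3 : ℕ) : ℤ))).toTopRep
          (cycSubgroup 3 0 r) 1 κ₀ = Ψ y →
      galoisCohomology.localization (WeierstrassCurve.torsionGaloisModule W' (((3 : ℕ) : ℤ) ^ j * ((3 : ℕ) : ℤ)))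
          (Sum.inr v') 1 κ₀ = tateLocalMap W' 3 j (Sum.inr v') h →
      ∃ l ∈ cycIntLattice 3 (cycLevel 3 0 r),
        ((1 : ℚ_[3]) ⊗ₜ[ℚ] (θ' r : CyclotomicField (cycLevel 3 0 r) ℚ)) *
            ((((3 : ℕ) : ℤ_[3]) ^ b) • ((φ0 h ⊗ₜ[ℚ] (1 : CyclotomicField (cycLevel 3 0 r) ℚ)) - Λ' 0 r y)) =
          (((3 : ℕ) : ℤ_[3]) ^ (j + 1)) • (l : ℚ_[3] ⊗[ℚ] CyclotomicField (cycLevel 3 0 r) ℚ)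

/-- Local notation: **admissible weights** — at every level `r`, `1 ⊗ θ_r ∈ L_int` and `(1 ⊗ θ_r)²·l₀ = 3 ⊗ 1`
for some `l₀ ∈ L_int` (so `θ_r² ∣ 3` in `ℤ₃ ⊗ ℤ[ζ_m]`: `θ_r = 1`, or `θ_r = 1 − ζ₃` when `3 ∣ m`). -/
local notation3 (prettyPrint := false) "WEIGHT⟦" θ' "⟧" =>
  ∀ r : Finset (HeightOneSpectrum (𝓞 ℚ)),
    ((1 : ℚ_[3]) ⊗ₜ[ℚ] (θ' r : CyclotomicField (cycLevel 3 0 r) ℚ)) ∈ cycIntLattice 3 (cycLevel 3 0 r) ∧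
    ∃ l₀ ∈ cycIntLattice 3 (cycLevel 3 0 r),
      ((1 : ℚ_[3]) ⊗ₜ[ℚ] (θ' r : CyclotomicField (cycLevel 3 0 r) ℚ)) *
          ((1 : ℚ_[3]) ⊗ₜ[ℚ] (θ' r : CyclotomicField (cycLevel 3 0 r) ℚ)) * l₀ =
        ((3 : ℕ) : ℚ_[3]) ⊗ₜ[ℚ] (1 : CyclotomicField (cycLevel 3 0 r) ℚ)

/-- Local notation: **(C1ₑₓʷ) at the row `(W, v, P)`** — the DEFINED-KATO package with R-κ, `hker`, `hdual`,
admissible weights `θ`, the WEIGHTED compatibility COMPATW₁ at every depth, and Kato's `ZetaBody` family. -/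
local notation3 (prettyPrint := false) "DEFKATOW⟦" W' ", " v' ", " N' ", " P' "⟧" =>
  ∃ (ι : (n : ℕ) → (CyclotomicField n ℚ →+* ℂ)) (κK : ℝ)
    (Λ : ∀ (k' : ℕ) (r : Finset (HeightOneSpectrum (𝓞 ℚ))),
      H1 (tateRep W' 3) (cycSubgroup 3 k' r) →ₗ[ℤ_[3]] ℚ_[3] ⊗[ℚ] CyclotomicField (cycLevel 3 k' r) ℚ)
    (φ : (tateLocalRep W' 3 (Sum.inr v')).cohomology 1 →+ ℚ_[3])
    (θ : ∀ r : Finset (HeightOneSpectrum (𝓞 ℚ)), CyclotomicField (cycLevel 3 0 r) ℚ),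
    κK ≠ 0 ∧ (∃ u : ℚ, (u : ℝ) = κK ∧ padicValRat 3 u = 0) ∧
    (∀ y, φ y = 0 ↔ ∀ j : ℕ, tateLocalMap W' 3 j (Sum.inr v') y ∈
      WeierstrassCurve.kummerSelmerStructure W' (((3 : ℕ) : ℤ) ^ j * ((3 : ℕ) : ℤ)) (Sum.inr v')) ∧
    (∀ a : ℚ_[3], (∃ y, φ y = a) ↔
      ∀ Q : ((W' : WeierstrassCurve ℚ).baseChange ℚ_[3]).toAffine.Point,
        ‖a * padicLog ((W' : WeierstrassCurve ℚ).baseChange ℚ_[3]) Q‖ ≤ 1) ∧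
    WEIGHT⟦θ⟧ ∧
    (∀ j : ℕ, COMPATW⟦W', j, v', Λ, φ, 1, θ⟧) ∧
    ∀ (c d a : ℤ) (A : ℕ), 0 < A → Int.gcd c (6 * 3 * A) = 1 → Int.gcd d (6 * 3 * N') = 1 →
      ∃ (z : ∀ (k' : ℕ) (r : (cyclotomicLevelsRat 3 (badPlaces c d A N')).Ideals),
            H1 (tateRep W' 3) ((cyclotomicLevelsRat 3 (badPlaces c d A N')).level k' r.1))
        (x : ∀ (k' : ℕ) (r : (cyclotomicLevelsRat 3 (badPlaces c d A N')).Ideals),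
            CyclotomicField (cycLevel 3 k' r.1) ℚ),
        ZetaBody W' 3 (P' : ModularParametrizationData W' N').f ι κK Λ c d a A z x

/-! ### §1 `stub_nonAdditive` of crux 19599 from PUB + item 20275 + item 20397 -/

set_option backward.isDefEq.respectTransparency false in
/-- **`stub_nonAdditive` of crux 19599 (BC3 birth skeleton, VERBATIM) from the published leaves, item 20275
`DefinedKatoWeightedNonAdditiveThree` (non-additive rows) and item 20397 `FineKatoTauAnomalousThree` (good anomalous rows)
BY NAME.**  Gen 10's dispatch on the non-anomaly certificate `3 ∤ 3 + 𝟙_{3∤N} − a₃(W₀)`: the non-anomalous branch is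
gen 11's `shallowEqDeep_row_of_definedKatoWeighted_of_nonanomalous`; an anomalous row is GOOD (`a₃ = ±1` at a
multiplicative `3`), so `3 ∤ N` and gen 9's `shallowEqDeep_row_of_fineKatoτ_of_good` applies.  CONDITIONAL; nothing booked.
[cite: Kim2025RefinedTNC, Thm 1.2] [cite: Kim2022StructureSelmer, Thm. 1.9 (6), §3.2.3, Lemma 3.3/3.4, Thm. 3.13]
[cite: Sakamoto2024, Thm. 4.4 (p. 926)] [cite: MazurRubin2004, Thm. 5.2.12] [cite: BlochKato1990, §3 (Prop. 3.8, Ex. 3.11)]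
[cite: Silverman1994, IV.10.2(a)] [cite: SilvermanAEC2009, §C.16] -/
theorem stub19599_nonAdditive_of_weightedRouteItems
    (hS24 : Sakamoto2024.kolyvaginSystems_freeRankOne_zmod_three_pow)
    (hS24₂ : Sakamoto2024.kolyvaginSystems_idealOfBasis_eq_fittingIdeal_zmod_three_pow)
    (hGZK : rank_eq_analyticRank_of_analyticRank_le_one) (hPT : poitouTate_selmerStructure_duality ℚ)
    (h₁ : DefinedKatoWeightedNonAdditiveThree) (h₂ : FineKatoTauAnomalousThree) : STUB19599NA := by
  intro W₀ _ _ htow ht _ N _ hN D₀ hopt hdeg hint hord hA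
  obtain ⟨v₃, η, hv₃, hη⟩ := exists_place_three_and_generators
  have hf := D₀.isNewformOf
  by_cases h3a : (3 : ℤ) ∣ 3 + (if 3 ∣ N then 0 else 1) - W₀.LFunction 3
  · -- anomalous ⇒ good reduction at `3`
    have hgood : W₀.HasGoodReductionAtPrime 3 := by
      by_contra hgood
      have hmult : W₀.HasMultiplicativeReductionAtPrime 3 := by
        by_contra hm
        exact hA ⟨hgood, hm⟩
      have h3N : 3 ∣ N := by
        by_contra h3N
        rw [hN] at h3N
        exact hgood (hasGoodReductionAtPrime_three_of_not_dvd_conductorNorm W₀ h3N)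
      rw [if_pos h3N] at h3a
      by_cases hsplit : W₀.HasSplitMultiplicativeReductionAtPrime 3
      · have h1 : W₀.LFunction 3 = 1 := by
          have h := (hf.cuspCoeff_eq_one_and_sq_of_split hsplit).1
          rw [hf.2 3] at h
          exact_mod_cast h
        rw [h1] at h3a
        omega
      · have h1 : W₀.LFunction 3 = -1 := by
          have h := (hf.cuspCoeff_eq_neg_one_and_dvd_of_nonsplit hmult hsplit).1
          rw [hf.2 3] at h
          exact_mod_cast h
        rw [h1] at h3a
        omega
    have hN3 : ¬ 3 ∣ N := by
      rw [hN]
      exact not_dvd_conductorNorm_of_hasGoodReductionAtPrime W₀ hgood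
    rw [if_neg hN3] at h3a
    exact KimAtThreeShallowEqDeepAnomalousRows.shallowEqDeep_row_of_fineKatoτ_of_good W₀ hS24 hS24₂ hGZK hPT
      htow ht D₀ hN hint hord v₃ hv₃ η hη (hf.2 3) hN3
      (h₂ W₀ htow ht hN D₀ hopt hdeg hN3 v₃ hv₃ (W₀.LFunction 3) (hf.2 3) h3a)
  · -- non-anomalous: the WEIGHTED defined-Kato package (item 20275 read at the row)
    exact shallowEqDeep_row_of_definedKatoWeighted_of_nonanomalous W₀ hS24 hS24₂ hGZK hPT htow ht D₀ hN hint hord v₃ hv₃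
      η hη (hf.2 3) h3a (h₁ W₀ htow ht hN D₀ hopt hdeg hA v₃ hv₃)

/-! ### §2 Crux 19599 BY NAME -/

/-- **Crux 19599 `ShallowEqDeepOffKatoStratum` BY NAME ⟸ the three published leaves BY NAME ∧ the registered support items
20275 `DefinedKatoWeightedNonAdditiveThree` ∧ 20397 `FineKatoTauAnomalousThree` ∧ 20398 `FineKatoTwoExpDefectThree` BY NAME**
— the BC3 birth composition on §1 and seat acc3's `stub19599_additiveDefect_of_fineKato`.  CONDITIONAL on those items;
nothing booked; 19599 stays OPEN. [cite: Kim2025RefinedTNC, Thm 1.1, Thm 1.2]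
[cite: Kim2022StructureSelmer, Thm. 1.9 (6), Thm. 3.13] [cite: Sakamoto2024, Thm. 4.4 (p. 926)]
[cite: MazurRubin2004, Thm. 4.4.1 and Thm. 5.2.12] -/
theorem shallowEqDeepOffKatoStratum_of_weightedRouteItems
    (hSak : SakamotoKolyvaginThree) (hGZK : RankEqAnalyticRankLeOne) (hPT : PoitouTateSelmerDuality)
    (h₁ : DefinedKatoWeightedNonAdditiveThree) (h₂ : FineKatoTauAnomalousThree) (h₃ : FineKatoTwoExpDefectThree) :
    ShallowEqDeepOffKatoStratum := by
  intro W₀ _ _ htow ht hfin N _ hN D₀ hopt hdeg hint hord hoff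
  by_cases hA : (haveI : Fact (Nat.Prime 3) := ⟨Nat.prime_three⟩; Addv W₀ 3)
  · refine KimAtThreeOffStratumAdditiveDefectOfFineKato.stub19599_additiveDefect_of_fineKato hSak.1 hSak.2 hGZK hPT
      h₃ W₀ htow ht hfin hN D₀ hopt hdeg hint hord hA ?_
    by_contra hcon
    push Not at hcon
    exact hoff ⟨hA, hcon.1, hcon.2⟩
  · exact stub19599_nonAdditive_of_weightedRouteItems hSak.1 hSak.2 hGZK hPT h₁ h₂ W₀ htow ht hfin hN D₀ hopt hdeg
      hint hord hA

/-! ### §3 Crux 19077 BY NAME -/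

/-- **Crux 19077 `ShallowEqDeepAtTorsionFree` BY NAME ⟸ the four published leaves ∧ crux 19560 `KatoKuriharaPortThreeShared`
∧ items 20275 ∧ 20397 ∧ 20398, all BY NAME** — gen 4's stub-free glue `shallowEqDeepAtTorsionFree_of_parts_noStub` on §2; no
`StubAtEmptyLevelThree` (crux 19561) needed.  CONDITIONAL; nothing booked; 19077 stays OPEN.
[cite: Kim2025RefinedTNC, Thm 1.2] [cite: Sakamoto2024, Thm. 4.4 (p. 926)] [cite: MazurRubin2004, Thm. 4.4.1 and Thm. 5.2.12]
[cite: Kato2004Asterisque, Thm. 9.7 (p. 189), Ex. 13.3] [cite: Carayol1986] -/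
theorem shallowEqDeepAtTorsionFree_of_weightedRouteItems
    (hSak : SakamotoKolyvaginThree) (hGZK : RankEqAnalyticRankLeOne) (hPT : PoitouTateSelmerDuality)
    (hlev : CarayolLevelEqConductor) (hPort : KatoKuriharaPortThreeShared)
    (h₁ : DefinedKatoWeightedNonAdditiveThree) (h₂ : FineKatoTauAnomalousThree) (h₃ : FineKatoTwoExpDefectThree) :
    ShallowEqDeepAtTorsionFree :=
  shallowEqDeepAtTorsionFree_of_parts_noStub hSak hGZK hPT hlev hPort
    (shallowEqDeepOffKatoStratum_of_weightedRouteItems hSak hGZK hPT h₁ h₂ h₃)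

/-- **Crux 19077 BY NAME ⟸ alias 19598 `DeepUpperSplitSharedParts` ∧ items 20275 ∧ 20397 ∧ 20398 BY NAME** — the planner's
19600 decomposition `ShallowEqDeepOfParts` (glue `KimAtThreeShallowEqDeepSplitGlue.shallowEqDeepOfParts_proof`) fed with §2.
CONDITIONAL; nothing booked. [cite: Kim2025RefinedTNC, Thm 1.2] [cite: Sakamoto2024, Thm. 4.4 (p. 926)]
[cite: MazurRubin2004, Thm. 4.4.1 and Thm. 5.2.12] [cite: Carayol1986] -/
theorem shallowEqDeepAtTorsionFree_of_sharedParts_of_weightedRouteItems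
    (hU : DeepUpperSplitSharedParts)
    (h₁ : DefinedKatoWeightedNonAdditiveThree) (h₂ : FineKatoTauAnomalousThree) (h₃ : FineKatoTwoExpDefectThree) :
    ShallowEqDeepAtTorsionFree :=
  KimAtThreeShallowEqDeepSplitGlue.shallowEqDeepOfParts_proof hU
    (shallowEqDeepOffKatoStratum_of_weightedRouteItems hU.1 hU.2.1 hU.2.2.1 h₁ h₂ h₃)

/-! ### §4 Item 20275 token-for-token, and 20396 ⟹ 20275 BY NAME -/

/-- **Token-for-token: the registered support item 20275 `DefinedKatoWeightedNonAdditiveThree` IS the displayed `∀`-package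
`∀ rows, DEFKATOW⟦W₀, v₃, N, D₀⟧`** (gen 11's notation of `KimAtThreeShallowEqDeepOffStratumOfDefinedKatoWeighted`; `Iff.rfl`).
[folklore] -/
theorem definedKatoWeightedNonAdditiveThree_iff : DefinedKatoWeightedNonAdditiveThree ↔
    (∀ (W₀ : WeierstrassCurve ℚ) [W₀.IsElliptic] [W₀.IsGloballyMinimal],
      (∀ n : ℕ, W₀.HasSurjectiveModNGaloisRep (3 ^ n : ℕ)) →
      Nat.card {Q : (W₀.baseChange ℚ_[3]).toAffine.Point // (3 : ℕ) • Q = 0} = 1 →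
      ∀ {N : ℕ} [NeZero N], N = W₀.conductorNorm ℤ →
      ∀ (D₀ : ModularParametrizationData W₀ N),
        (∀ z ∈ D₀.L.lattice, ∃ w ∈ periodLattice D₀.f, z = D₀.c * w) →
        (∀ (W₂ : WeierstrassCurve ℚ) [W₂.IsElliptic] (D₂ : ModularParametrizationData W₂ N),
          D₂.f = D₀.f → D₀.modularDegree ≤ D₂.modularDegree) →
        ¬ (haveI : Fact (Nat.Prime 3) := ⟨Nat.prime_three⟩; Addv W₀ 3) →
      ∀ (v₃ : HeightOneSpectrum (𝓞 ℚ)), ((3 : ℕ) : 𝓞 ℚ) ∈ v₃.asIdeal →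
      ∀ [ContinuousSMul ℤ_[3] (W₀.tateModule 3)] [Module.Free ℤ_[3] (W₀.tateModule 3)]
        [Module.Finite ℤ_[3] (W₀.tateModule 3)], DEFKATOW⟦W₀, v₃, N, D₀⟧) :=
  Iff.rfl

set_option backward.isDefEq.respectTransparency false in
/-- **Item 20396 ⟹ item 20275, BY NAME** (`DefinedKatoUnitNonAdditiveThree → DefinedKatoWeightedNonAdditiveThree`, trivial
weights `θ_r := 1`, gen 11's `definedKatoWeighted_of_definedKatoUnit`): nothing registered goes stale. [folklore] -/
theorem definedKatoWeightedNonAdditiveThree_of_definedKatoUnitNonAdditiveThree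
    (h : DefinedKatoUnitNonAdditiveThree) : DefinedKatoWeightedNonAdditiveThree := by
  intro W₀ _ _ htow ht N _ hN D₀ hlat hdeg hna v₃ hv₃ _ _ _
  exact definedKatoWeighted_of_definedKatoUnit W₀ D₀ (h W₀ htow ht hN D₀ hlat hdeg hna v₃ hv₃)

end Summit.BirchSwinnertonDyer.BirchSwinnertonDyer.Theorems.KimAtThreeShallowEqDeepWeightedItems

end
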